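import Summits.AtomisticToContinuum.Crystallization.Theorems.ExcessDecayLiouvilleMassData
import Summits.AtomisticToContinuum.Crystallization.Theorems.ExcessDecayLiouvilleDyadicFarMass
import Summits.AtomisticToContinuum.Crystallization.Theorems.ExcessDecayLiouvilleCutoff

/-!
# Route `ExcessDecayLiouville`: currencies of the harmonic replacement `h = v + w` (nonlinear half, XVIII)

Harmonic-replacement architecture for item `ExcessDecay` (stmt-AtomisticToContinuum-9334), nonlinear half.
The linear decay step consumes the masses `𝐌[h, X]`, `𝐉[h, Y]` and the gradient far masses `𝐉[Δ_τ h, Y]` of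
`h = v + w`; they are bounded by those of `v` and the total mass / energy of the correction `w`:
* `mass_add_le` : `𝐌[v + w, X] ≤ 2𝐌[v, X] + 2 Σ'‖w‖²`;
* `farMass_add_le` : `𝐉[v + w, Y] ≤ 2𝐉[v, Y] + 2 Y⁻⁸ Σ'‖w‖²`;
* `farMass_diff_add_le` : `𝐉[Δ_τ(v + w), Y] ≤ 2𝐉[Δ_τ v, Y] + 2 Y⁻⁸ Σ'‖Δ_τ w‖²`, and `Σ'‖Δ_τ w‖² ≤ nnForm w`
  (`4 nnForm w` for the two-layer vector) by the translation lemmas of `ExcessDecayLiouvilleCutoff` /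
  `ExcessDecayLiouvilleVerticalDifferences`;
* `farMass_diff_le_dyadic_NN` : `𝐉[Δ_τ v, Y] ≤ Σ_{n ≤ K} (2ⁿY)⁻⁸ · c_τ NN[v, c₀, 2^{n+1}Y + 3]` (dyadic
  decomposition and `sum_translate_sq_le_NN` / `sum_vertical_sq_le_NN`).
All `[folklore]`; helper lemmas, nothing here closes an item.
-/

noncomputable section

namespace Summit.AtomisticToContinuum.Crystallization.Theorems.ExcessDecayLiouville

open scoped BigOperators Topology Classical
open Literature.MathematicalPhysics.StatisticalMechanics
open Summit.AtomisticToContinuum.Crystallization.Theorems.PhononStabilityNegative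

set_option quotPrecheck false in
-- Local notation: ball indicator.
local notation "𝟙ᵇ[" x ", " c ", " R "]" => (if dist (x : EuclideanSpace ℝ (Fin 3)) c ≤ R then (1 : ℝ) else 0)

section

variable {t : Fin 2 → (EuclideanSpace ℝ (Fin 3))} {A : (EuclideanSpace ℝ (Fin 3)) →L[ℝ] (EuclideanSpace ℝ (Fin 3))}
  {c₀ : EuclideanSpace ℝ (Fin 3)}

variable (hA : Adm₀ A) (hI : Inner₀ t A)

set_option quotPrecheck false in
-- local mass on the ball of radius `X` about `c₀`
local notation "𝐌[" f ", " X "]" =>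
  tsum (fun p : Sites₀ t A => ‖f (p : EuclideanSpace ℝ (Fin 3))‖ ^ 2 * 𝟙ᵇ[p, c₀, X])
set_option quotPrecheck false in
-- weighted far mass with floor `Y` about `c₀`
local notation "𝐉[" f ", " Y "]" =>
  tsum (fun q : Sites₀ t A => ‖f (q : EuclideanSpace ℝ (Fin 3))‖ ^ 2 * (max (dist (q : EuclideanSpace ℝ (Fin 3)) c₀) Y)⁻¹ ^ 8)
set_option quotPrecheck false in
-- Local notation: the finite near-neighbour form on the ball of radius `X` about `c₀`.
local notation "NN[" v ", " X "]" =>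
  (∑ p ∈ (finite_sites_dist_le (t := t) (A := A) hA hI c₀ X).toFinset,
    ∑ q ∈ (finite_sites_dist_le (t := t) (A := A) hA hI c₀ X).toFinset,
      (if p ≠ q ∧ dist p q ≤ 11 / 10 then ‖v p - v q‖ ^ 2 else (0 : ℝ)))

/-- `‖a + b‖² ≤ 2‖a‖² + 2‖b‖²`. [folklore] -/
theorem norm_add_sq_le_two_mul (a b : EuclideanSpace ℝ (Fin 3)) : ‖a + b‖ ^ 2 ≤ 2 * ‖a‖ ^ 2 + 2 * ‖b‖ ^ 2 := by
  have h1 : ‖a + b‖ ^ 2 ≤ (‖a‖ + ‖b‖) ^ 2 := pow_le_pow_left₀ (norm_nonneg _) (norm_add_le a b) 2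
  nlinarith [sq_nonneg (‖a‖ - ‖b‖)]

/-- **Mass of a sum**: `𝐌[v + w, X] ≤ 2𝐌[v, X] + 2 Σ'‖w‖²`. [folklore] -/
theorem mass_add_le {v w : (EuclideanSpace ℝ (Fin 3)) → (EuclideanSpace ℝ (Fin 3))}
    (hv : (Function.support v).Finite) (hw : (Function.support w).Finite) (X : ℝ) :
    𝐌[(fun x => v x + w x), X] ≤ 2 * 𝐌[v, X] + 2 * ∑' q : Sites₀ t A, ‖w q‖ ^ 2 := by
  have h1 := summable_normSq_mul_of_finite (t := t) (A := A) hv (fun q => 𝟙ᵇ[q, c₀, X])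
  have h2 : Summable (fun q : Sites₀ t A => ‖w q‖ ^ 2) := by
    have := summable_normSq_mul_of_finite (t := t) (A := A) hw (fun _ => (1 : ℝ))
    simpa using this
  have hvw : (Function.support (fun x => v x + w x)).Finite := by
    refine (hv.union hw).subset fun x hx => ?_
    simp only [Function.mem_support, ne_eq, Set.mem_union] at hx ⊢
    by_contra h
    push Not at h
    exact hx (by rw [h.1, h.2, add_zero])
  have h3 := summable_normSq_mul_of_finite (t := t) (A := A) hvw (fun q => 𝟙ᵇ[q, c₀, X])
  have hpt : ∀ q : Sites₀ t A, ‖(fun x => v x + w x) q‖ ^ 2 * 𝟙ᵇ[q, c₀, X] ≤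
      2 * (‖v q‖ ^ 2 * 𝟙ᵇ[q, c₀, X]) + 2 * ‖w q‖ ^ 2 := by
    intro q
    have hind0 : 0 ≤ 𝟙ᵇ[q, c₀, X] := by positivity
    have hind1 : 𝟙ᵇ[q, c₀, X] ≤ 1 := by split_ifs <;> norm_num
    have hw2 : 0 ≤ 2 * ‖w q‖ ^ 2 := by positivity
    calc ‖v q + w q‖ ^ 2 * 𝟙ᵇ[q, c₀, X] ≤ (2 * ‖v q‖ ^ 2 + 2 * ‖w q‖ ^ 2) * 𝟙ᵇ[q, c₀, X] :=
          mul_le_mul_of_nonneg_right (norm_add_sq_le_two_mul _ _) hind0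
      _ = 2 * (‖v q‖ ^ 2 * 𝟙ᵇ[q, c₀, X]) + 2 * ‖w q‖ ^ 2 * 𝟙ᵇ[q, c₀, X] := by ring
      _ ≤ 2 * (‖v q‖ ^ 2 * 𝟙ᵇ[q, c₀, X]) + 2 * ‖w q‖ ^ 2 * 1 := by gcongr
      _ = _ := by ring
  calc 𝐌[(fun x => v x + w x), X] ≤ ∑' q : Sites₀ t A, (2 * (‖v q‖ ^ 2 * 𝟙ᵇ[q, c₀, X]) + 2 * ‖w q‖ ^ 2) :=
        Summable.tsum_le_tsum hpt h3 ((h1.mul_left 2).add (h2.mul_left 2))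
    _ = 2 * 𝐌[v, X] + 2 * ∑' q : Sites₀ t A, ‖w q‖ ^ 2 := by
        rw [(h1.mul_left 2).tsum_add (h2.mul_left 2), tsum_mul_left, tsum_mul_left]

/-- **Weighted far mass of a sum**: `𝐉[v + w, Y] ≤ 2𝐉[v, Y] + 2 Y⁻⁸ Σ'‖w‖²` (`Y > 0`). [folklore] -/
theorem farMass_add_le {v w : (EuclideanSpace ℝ (Fin 3)) → (EuclideanSpace ℝ (Fin 3))}
    (hv : (Function.support v).Finite) (hw : (Function.support w).Finite) {Y : ℝ} (hY : 0 < Y) :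
    𝐉[(fun x => v x + w x), Y] ≤ 2 * 𝐉[v, Y] + 2 * Y⁻¹ ^ 8 * ∑' q : Sites₀ t A, ‖w q‖ ^ 2 := by
  have h1 := summable_normSq_mul_of_finite (t := t) (A := A) hv
    (fun q => (max (dist (q : EuclideanSpace ℝ (Fin 3)) c₀) Y)⁻¹ ^ 8)
  have h2 : Summable (fun q : Sites₀ t A => ‖w q‖ ^ 2) := by
    have := summable_normSq_mul_of_finite (t := t) (A := A) hw (fun _ => (1 : ℝ))
    simpa using this
  have hvw : (Function.support (fun x => v x + w x)).Finite := by
    refine (hv.union hw).subset fun x hx => ?_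
    simp only [Function.mem_support, ne_eq, Set.mem_union] at hx ⊢
    by_contra h
    push Not at h
    exact hx (by rw [h.1, h.2, add_zero])
  have h3 := summable_normSq_mul_of_finite (t := t) (A := A) hvw
    (fun q => (max (dist (q : EuclideanSpace ℝ (Fin 3)) c₀) Y)⁻¹ ^ 8)
  have hpt : ∀ q : Sites₀ t A, ‖(fun x => v x + w x) q‖ ^ 2 * (max (dist (q : EuclideanSpace ℝ (Fin 3)) c₀) Y)⁻¹ ^ 8 ≤
      2 * (‖v q‖ ^ 2 * (max (dist (q : EuclideanSpace ℝ (Fin 3)) c₀) Y)⁻¹ ^ 8) + 2 * Y⁻¹ ^ 8 * ‖w q‖ ^ 2 := by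
    intro q
    have hw0 : 0 ≤ (max (dist (q : EuclideanSpace ℝ (Fin 3)) c₀) Y)⁻¹ ^ 8 := by positivity
    have hwY : (max (dist (q : EuclideanSpace ℝ (Fin 3)) c₀) Y)⁻¹ ^ 8 ≤ Y⁻¹ ^ 8 :=
      pow_le_pow_left₀ (by positivity) ((inv_le_inv₀ (lt_max_of_lt_right hY) hY).2 (le_max_right _ _)) 8
    have hw2 : 0 ≤ 2 * ‖w q‖ ^ 2 := by positivity
    calc ‖v q + w q‖ ^ 2 * (max (dist (q : EuclideanSpace ℝ (Fin 3)) c₀) Y)⁻¹ ^ 8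
        ≤ (2 * ‖v q‖ ^ 2 + 2 * ‖w q‖ ^ 2) * (max (dist (q : EuclideanSpace ℝ (Fin 3)) c₀) Y)⁻¹ ^ 8 :=
          mul_le_mul_of_nonneg_right (norm_add_sq_le_two_mul _ _) hw0
      _ = 2 * (‖v q‖ ^ 2 * (max (dist (q : EuclideanSpace ℝ (Fin 3)) c₀) Y)⁻¹ ^ 8) +
          2 * ‖w q‖ ^ 2 * (max (dist (q : EuclideanSpace ℝ (Fin 3)) c₀) Y)⁻¹ ^ 8 := by ring
      _ ≤ 2 * (‖v q‖ ^ 2 * (max (dist (q : EuclideanSpace ℝ (Fin 3)) c₀) Y)⁻¹ ^ 8) + 2 * ‖w q‖ ^ 2 * Y⁻¹ ^ 8 := by gcongr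
      _ = _ := by ring
  calc 𝐉[(fun x => v x + w x), Y]
      ≤ ∑' q : Sites₀ t A, (2 * (‖v q‖ ^ 2 * (max (dist (q : EuclideanSpace ℝ (Fin 3)) c₀) Y)⁻¹ ^ 8) + 2 * Y⁻¹ ^ 8 * ‖w q‖ ^ 2) :=
        Summable.tsum_le_tsum hpt h3 ((h1.mul_left 2).add (h2.mul_left _))
    _ = 2 * 𝐉[v, Y] + 2 * Y⁻¹ ^ 8 * ∑' q : Sites₀ t A, ‖w q‖ ^ 2 := by
        rw [(h1.mul_left 2).tsum_add (h2.mul_left _), tsum_mul_left, tsum_mul_left]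

include hA hI in
/-- **Lattice differences of the correction**: `Σ'‖w(q + Aτ) − w q‖² ≤ nnForm w` for `τ ∈ Λ₀` with `‖Aτ‖ ≤ 11/10`,
and `≤ 4 nnForm w` for the two-layer vector. [folklore] -/
theorem tsum_diff_sq_le_nnForm {w : (EuclideanSpace ℝ (Fin 3)) → (EuclideanSpace ℝ (Fin 3))}
    (hw : (Function.support w).Finite) {τ : EuclideanSpace ℝ (Fin 3)} (hτ : τ ∈ Λ₀) (hτn : ‖A τ‖ ≤ 11 / 10) :
    ∑' q : Sites₀ t A, ‖(fun x => w (x + A τ) - w x) q‖ ^ 2 ≤ nnForm t A w := by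
  have h := tsum_norm_sub_translate_sq_le_nnForm hA hI hw hτ hτn
  refine le_of_eq_of_le (tsum_congr fun q => ?_) h
  simp only []
  rw [← norm_neg, neg_sub]

include hA hI in
/-- The two-layer version. [folklore] -/
theorem tsum_vdiff_sq_le_nnForm {w : (EuclideanSpace ℝ (Fin 3)) → (EuclideanSpace ℝ (Fin 3))}
    (hw : (Function.support w).Finite) :
    ∑' q : Sites₀ t A, ‖(fun x => w (x + A (layerNormal (2 * Real.sqrt (2 / 3)))) - w x) q‖ ^ 2 ≤ 4 * nnForm t A w := by
  have h := tsum_norm_sub_vertical_sq_le_nnForm hA hI hw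
  refine le_of_eq_of_le (tsum_congr fun q => ?_) h
  simp only []
  rw [← norm_neg, neg_sub]

/-- **Gradient far mass of a sum**: `𝐉[Δ_τ(v + w), Y] ≤ 2𝐉[Δ_τ v, Y] + 2 Y⁻⁸ Σ'‖Δ_τ w‖²`. [folklore] -/
theorem farMass_diff_add_le {v w : (EuclideanSpace ℝ (Fin 3)) → (EuclideanSpace ℝ (Fin 3))}
    (hv : (Function.support v).Finite) (hw : (Function.support w).Finite) (τ : EuclideanSpace ℝ (Fin 3))
    {Y : ℝ} (hY : 0 < Y) :
    𝐉[(fun x => (fun y => v y + w y) (x + A τ) - (fun y => v y + w y) x), Y] ≤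
      2 * 𝐉[(fun x => v (x + A τ) - v x), Y] + 2 * Y⁻¹ ^ 8 * ∑' q : Sites₀ t A, ‖(fun x => w (x + A τ) - w x) q‖ ^ 2 := by
  have hvτ : (Function.support (fun x => v (x + A τ) - v x)).Finite := by
    refine ((hv.preimage (add_left_injective (A τ)).injOn).union hv).subset fun x hx => ?_
    simp only [Function.mem_support, ne_eq, Set.mem_union, Set.mem_preimage] at hx ⊢
    by_contra h
    push Not at h
    exact hx (by rw [h.1, h.2, sub_zero])
  have hwτ : (Function.support (fun x => w (x + A τ) - w x)).Finite := by
    refine ((hw.preimage (add_left_injective (A τ)).injOn).union hw).subset fun x hx => ?_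
    simp only [Function.mem_support, ne_eq, Set.mem_union, Set.mem_preimage] at hx ⊢
    by_contra h
    push Not at h
    exact hx (by rw [h.1, h.2, sub_zero])
  have h := farMass_add_le (t := t) (A := A) (c₀ := c₀) hvτ hwτ hY
  refine le_of_eq_of_le (tsum_congr fun q => ?_) h
  simp only []
  congr 2
  abel

include hA hI in
/-- **Gradient far mass of `v` through the dyadic `NN` sums**: for `τ ∈ Λ₀` a bond vector (`Aτ ≠ 0`,
`‖Aτ‖ ≤ 11/10`), `𝐉[Δ_τ v, Y] ≤ Σ_{n ≤ K} (2ⁿY)⁻⁸ NN[v, c₀, 2^{n+1}Y + 3]`. [folklore] -/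
theorem farMass_diff_le_dyadic_NN (v : (EuclideanSpace ℝ (Fin 3)) → (EuclideanSpace ℝ (Fin 3)))
    (hv : (Function.support v).Finite) {τ : EuclideanSpace ℝ (Fin 3)} (hτ : τ ∈ Λ₀) (hτ0 : A τ ≠ 0)
    (hτn : ‖A τ‖ ≤ 11 / 10) {Y : ℝ} (hY : 0 < Y) (K : ℕ)
    (hK : ∀ x, v (x + A τ) - v x ≠ 0 → dist x c₀ ≤ 2 ^ (K + 1) * Y) :
    𝐉[(fun x => v (x + A τ) - v x), Y] ≤
      ∑ n ∈ Finset.range (K + 1), ((2 : ℝ) ^ n * Y)⁻¹ ^ 8 * NN[v, 2 ^ (n + 1) * Y + 3] := by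
  have hg0 : ∀ x, 0 ≤ (fun x => ‖v (x + A τ) - v x‖ ^ 2) x := fun x => by positivity
  have hvτ : (Function.support (fun x => v (x + A τ) - v x)).Finite := by
    refine ((hv.preimage (add_left_injective (A τ)).injOn).union hv).subset fun x hx => ?_
    simp only [Function.mem_support, ne_eq, Set.mem_union, Set.mem_preimage] at hx ⊢
    by_contra h
    push Not at h
    exact hx (by rw [h.1, h.2, sub_zero])
  have hgfin : (Function.support (fun x => ‖v (x + A τ) - v x‖ ^ 2)).Finite := by
    refine hvτ.subset fun x hx => ?_
    simp only [Function.mem_support, ne_eq] at hx ⊢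
    intro h0; apply hx; rw [h0, norm_zero]; ring
  have hK' : ∀ x, (fun x => ‖v (x + A τ) - v x‖ ^ 2) x ≠ 0 → dist x c₀ ≤ 2 ^ (K + 1) * Y := by
    intro x hx; apply hK x; intro h0; apply hx; simp only []; rw [h0, norm_zero]; ring
  have hdy := farMass_le_dyadic (t := t) (A := A) (fun x => ‖v (x + A τ) - v x‖ ^ 2) hg0 hgfin c₀ hY K hK'
  refine hdy.trans (Finset.sum_le_sum fun n _ => mul_le_mul_of_nonneg_left ?_ (by positivity))
  rw [tsum_indicator_eq_sum hA hI (fun x => ‖v (x + A τ) - v x‖ ^ 2) c₀ (2 ^ (n + 1) * Y)]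
  exact (sum_translate_sq_le_NN hA hI v _ hτ hτ0 hτn).trans (NN_mono hA hI v (by linarith))

include hA hI in
/-- The two-layer version: `𝐉[Δ_{w₃} v, Y] ≤ Σ_{n ≤ K} (2ⁿY)⁻⁸ · 4 NN[v, c₀, 2^{n+1}Y + 3]`. [folklore] -/
theorem farMass_vdiff_le_dyadic_NN (v : (EuclideanSpace ℝ (Fin 3)) → (EuclideanSpace ℝ (Fin 3)))
    (hv : (Function.support v).Finite) {Y : ℝ} (hY : 0 < Y) (K : ℕ)
    (hK : ∀ x, v (x + A (layerNormal (2 * Real.sqrt (2 / 3)))) - v x ≠ 0 → dist x c₀ ≤ 2 ^ (K + 1) * Y) :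
    𝐉[(fun x => v (x + A (layerNormal (2 * Real.sqrt (2 / 3)))) - v x), Y] ≤
      ∑ n ∈ Finset.range (K + 1), ((2 : ℝ) ^ n * Y)⁻¹ ^ 8 * (4 * NN[v, 2 ^ (n + 1) * Y + 3]) := by
  have hg0 : ∀ x, 0 ≤ (fun x => ‖v (x + A (layerNormal (2 * Real.sqrt (2 / 3)))) - v x‖ ^ 2) x := fun x => by positivity
  have hvτ : (Function.support (fun x => v (x + A (layerNormal (2 * Real.sqrt (2 / 3)))) - v x)).Finite := by
    refine ((hv.preimage (add_left_injective (A (layerNormal (2 * Real.sqrt (2 / 3))))).injOn).union hv).subset fun x hx => ?_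
    simp only [Function.mem_support, ne_eq, Set.mem_union, Set.mem_preimage] at hx ⊢
    by_contra h
    push Not at h
    exact hx (by rw [h.1, h.2, sub_zero])
  have hgfin : (Function.support (fun x => ‖v (x + A (layerNormal (2 * Real.sqrt (2 / 3)))) - v x‖ ^ 2)).Finite := by
    refine hvτ.subset fun x hx => ?_
    simp only [Function.mem_support, ne_eq] at hx ⊢
    intro h0; apply hx; rw [h0, norm_zero]; ring
  have hK' : ∀ x, (fun x => ‖v (x + A (layerNormal (2 * Real.sqrt (2 / 3)))) - v x‖ ^ 2) x ≠ 0 → dist x c₀ ≤ 2 ^ (K + 1) * Y := by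
    intro x hx; apply hK x; intro h0; apply hx; simp only []; rw [h0, norm_zero]; ring
  have hdy := farMass_le_dyadic (t := t) (A := A) (fun x => ‖v (x + A (layerNormal (2 * Real.sqrt (2 / 3)))) - v x‖ ^ 2)
    hg0 hgfin c₀ hY K hK'
  refine hdy.trans (Finset.sum_le_sum fun n _ => mul_le_mul_of_nonneg_left ?_ (by positivity))
  rw [tsum_indicator_eq_sum hA hI (fun x => ‖v (x + A (layerNormal (2 * Real.sqrt (2 / 3)))) - v x‖ ^ 2) c₀ (2 ^ (n + 1) * Y)]
  exact sum_vertical_sq_le_NN hA hI v _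

end

end Summit.AtomisticToContinuum.Crystallization.Theorems.ExcessDecayLiouville

end
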